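import Literature.MathematicalPhysics.QuantumFieldTheory.Balaban1983to89.B2Sect3AGaussianStep
import Literature.MathematicalPhysics.QuantumFieldTheory.Balaban1983to89.B2Eq236Replacements

/-!
# `Balaban1983to89.B2Eq278QuarticTransfer` — [Balaban1982Higgs2] (2.78)–(2.79) p. 574: after Lemma 2.4 the quartic
# term of (2.57) on `B^k(Λ₇^{(k−1)′} ∩ Λ₇^{(k)c})` is re-expressed through the unit-lattice field `φ` with an error
# `O((L^kε)^{κ₀})` per site (2.78), and the large-field characteristic function `χ^c_{R_s^{(k)}}` turns it into the
# convergence factor `exp(−p(L^kε)⁴|R_s^{(k)}|)` (2.79) — PROVED (theorems only)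

statement-level skeleton of published theorems with citation tags; proofs where landed; nothing here is a claim about the Yang–Mills mass gap

PDF held: `paper:balaban1982-cmp86-higgs23-ii` p. 574 [PDF 20] (with p. 570 [PDF 16] for (2.55)–(2.57), p. 572 [PDF 18]
for (2.65), p. 557 [PDF 3] for p(·), λ(·) and the threshold of (2.2)); read on the ×2 renders
`pub-balaban/b2b-balaban-ref1/pages/1982-cmp86-higgs23-II/1982-cmp86-higgs23-II-p020-x2.png` (and `…-p016-x2.png`).

CITATION HEADER (lean-in-tree rule).  T. Bałaban, *(Higgs)₂,₃ quantum fields in a finite volume. II. An upper bound*,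
Commun. Math. Phys. **86** (1982) 555–594 [Balaban1982Higgs2]: displays (2.78), (2.79) p. 574, with (2.55)–(2.57)
p. 570, Lemma 2.4 (2.65) p. 572 and (2.2)/(2.5) p. 557.  Cell `lit-balaban` (HOME `run/shared/lean/pub/lit-balaban/`),
reader / fold-owner seat **r02** gen 24 (unit `lit-balaban-r02`); SKELETON row **B2.Eq2.78-2.80** (new owner row: the
displays (2.78)–(2.80) between Lemma 2.4 and Lemma 2.5 had no row; (2.80) itself is `B2Eq287Translation`, seat p15,
and is not touched here).  USED BY NAME, never restated: `B2.pFn` (p(·), p. 557), `B2LargeField.lambdaEps` (λ(·) of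
(2.5)), `B2LargeField.thrPhi` (the `|φ|` threshold of (2.2)), `B2Sect3AGaussianStep.one_add_log_inv_rpow_mul_rpow_le`
(a logarithm loses to every power), `B2Eq236Replacements.pFn_nonneg`.  RELATED, not used: the first-step twin of (2.79) is (2.13) p. 559 with the mass counterterm,
`B2Ineq213SmallFactors.ineq213_chi` (seat p15; abstract threshold `θ`, exponent `½p(ε)⁴`, factor `exp(O(ε^{κ₀})|Λ₇ᶜ|)`);
at the k-th step the removed interaction is the pure quartic (p. 570 *«we remove the interaction from the set
B^k(Λ₇^{(k−1)′}∩Λ₇^{(k)c}) leaving the expression −λ(L^jε)Σ η^d|φ^{(k)}(x)|⁴ only»*), whence the full `p(L^kε)⁴` of (2.79),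
proved here with the threshold of (2.5) unfolded (`thrPhi`, `λ(L^kε)^{1/4}`).

WHAT IS PRINTED (p. 574 [PDF 20], verbatim).  *«Now we can use (2.65) to estimate the first term on the right side of
(2.57): −λ(L^kε) Σ_{x∈B^k(Λ₇^{(k−1)′}∩Λ₇^{(k)c})} η^d|φ^{(k)}(x)|⁴ = −λ(L^kε) Σ_{y∈Λ₇^{(k−1)′}∩Λ₇^{(k)c}} |φ(y)|⁴
+ O((L^kε)^{κ₀})|Λ₇^{(k−1)′}∩Λ₇^{(k)c}|. (2.78)  Of course there holds
χ^c_{R_s^{(k)}} exp(−λ(L^kε) Σ_{y∈Λ₇^{(k−1)′}∩Λ₇^{(k)c}} |φ(y)|⁴) ≤ exp(−p(L^kε)⁴|R_s^{(k)}|). (2.79)  Let us introduce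
the functions ζ_{Λ₀^{(k)}} by the formula (2.15) with the obvious modifications.»*  Context used: p. 570 *«only,
η = L^{−k}»* (so `Σ_{x∈B^k(y)} η^d = 1` on every k-block); Lemma 2.4 (2.65) p. 572 *«φ^{(k)}(x) = U(A^{(k)}(Γ^{(k)}_{x,y}))
φ(y) + O(p(L^kε)) … for x ∈ B^k(y), y ∈ Λ₇^{(k−1)′}»*; (2.55) p. 570, fourth restriction *«|φ(x)| ≤
c₁λ(L^{k−1}ε)^{−1/4}p(L^{k−1}ε) for x ∈ Λ^{(k−1)′}_{−1}»*; p. 570 *«The restrictions are identical to these considered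
in the first step, Sect. A, and are given by (2.4)–(2.6), with the replacements of ε by L^kε …»*, so that
χ^c_{R_s^{(k)}} = Π_{y∈R_s^{(k)}} χ({|φ(y)| > λ(L^kε)^{−1/4}p(L^kε)}) ((2.5) p. 557).

WHAT THIS FILE PROVES (kernel-checked, zero `sorry`; theorems only — no new definition, no `Prop` fact).
* §1 the estimate behind (2.78), per k-block and summed — `abs_pow_four_sub_pow_four_le`, `quartic278_block`,
  **`quartic278_sum`**: for blocks `B^k(y)` with weights `η^d ≥ 0` summing to `1`, a transport `U` preserving `|φ(y)|`,
  the deviation of (2.65) `|φ^{(k)}(x) − U(A^{(k)}(Γ^{(k)}_{x,y}))φ(y)| ≤ δ` and the bound of (2.55) `|φ(y)| ≤ M` on the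
  summation set `S`:  `|λ_k Σ_{y∈S}Σ_{x∈B^k(y)} η^d|φ^{(k)}(x)|⁴ − λ_k Σ_{y∈S}|φ(y)|⁴| ≤ λ_k·4δ(M + δ)³·|S|`.
* §2 the printed rate — `quartic278_rate`: with the printed sizes `λ_k = λ(L^kε)`, `δ = C·p(L^kε)` (Lemma 2.4) and
  `M = c₁p(L^{k−1}ε)λ(L^{k−1}ε)^{−1/4}` ((2.55)), for `d < 4` and EVERY `0 < κ₀ < (4 − d)/4` there is `C′` with
  `λ_k·4δ(M + δ)³ ≤ C′(L^kε)^{κ₀}` for all `0 < L^kε ≤ 1` (`L ≥ 1`); **`eq278_printed`** = §1 + §2: the error term of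
  (2.78) is `≤ C′(L^kε)^{κ₀}|S|`.
* §3 (2.79) — `pow_four_lt_of_thrPhi_lt` (a large-field site carries `λ(L^kε)|φ(y)|⁴ > p(L^kε)⁴`), **`ineq279`** (on the
  support of `χ^c_{R_s^{(k)}}`) and **`ineq279_printed`** (literally, the characteristic function written as the product of
  the indicators of (2.5)): `χ^c_{R_s^{(k)}}·exp(−λ(L^kε)Σ_{y∈S}|φ(y)|⁴) ≤ exp(−p(L^kε)⁴|R_s^{(k)}|)` whenever `R_s^{(k)} ⊆ S`.

HONEST SCOPE.  (i) Schematic carrier, as in the pre-cell `…B2` treatment of the Lemma-2.4 proof displays: sites, k-blocks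
and fields are abstract (`S : Finset Y`, `B : Y → Finset X`, weights `w`, fields with values in a real normed group), not
the concrete (Higgs)₂,₃ tower of `B1RG242`/`B2Eq243RegionsTower`; (ii) (2.65) and (2.55) enter as LOCATED printed-shape
hypotheses (rows B2.Lem2.4 — proved for the model family, `B2Lemma24Proof` — and B2.Eq2.55), exactly the two inputs the
sentence *«Now we can use (2.65) …»* names; (iii) the exponent this step yields is any `κ₀ < (4 − d)/4` (print: an
unspecified `κ₀ > 0`, cf. (2.68) *«κ₀ > 0»*); constants are explicit but not optimised; (iv) in (2.79) the inclusion
`R_s^{(k)} ⊆ Λ₇^{(k−1)′} ∩ Λ₇^{(k)c}` is the hypothesis `hR` (in print it holds because the step-k large-field sets lie in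
`Λ₇^{(k−1)′}` and `Λ₀^{(k)c} ⊆ Λ₇^{(k)c}`, (2.7) with ε → L^kε, p. 570); (v) (2.80) and the sentence on ζ_{Λ₀^{(k)}} are
not reproduced here (`B2Eq287Translation`, `B2Sect2Statements.zeta15`).  Unit `lit-balaban-r02` gen 24
(literature-prover-lit-balaban-r02-g24-0).
-/

open scoped BigOperators

noncomputable section

namespace Literature.MathematicalPhysics.QuantumFieldTheory.Balaban1983to89.B2Eq278QuarticTransfer

open Literature.MathematicalPhysics.QuantumFieldTheory.Balaban1983to89.B2LargeField (lambdaEps thrPhi lambdaEps_pos)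

/-! ## §0 Tools: `p(·)` across one scale, fourth powers -/

section Tools

/-- `p(·)` is decreasing on `(0, 1]`: `p(L^kε) ≤ p(L^{k−1}ε)` (`0 < ℓ′ ≤ ℓ ≤ 1`, `b₀ ≥ 0`, exponent `p ≥ 0`).
[cite: Balaban1982Higgs2, p.557] -/
theorem pFn_le_pFn_of_le {b₀ p ℓ ℓ' : ℝ} (hb₀ : 0 ≤ b₀) (hp : 0 ≤ p) (hℓ' : 0 < ℓ') (hle : ℓ' ≤ ℓ) (hℓ1 : ℓ ≤ 1) :
    B2.pFn b₀ p ℓ ≤ B2.pFn b₀ p ℓ' := by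
  unfold B2.pFn
  have hℓ : 0 < ℓ := lt_of_lt_of_le hℓ' hle
  have h0 : 0 ≤ 1 + Real.log ℓ⁻¹ := by
    rw [Real.log_inv]; have := Real.log_nonpos hℓ.le hℓ1; linarith
  have h1 : 1 + Real.log ℓ⁻¹ ≤ 1 + Real.log ℓ'⁻¹ := by
    rw [Real.log_inv, Real.log_inv]; have := Real.log_le_log hℓ' hle; linarith
  exact mul_le_mul_of_nonneg_left (Real.rpow_le_rpow h0 h1 hp) hb₀

/-- The elementary inequality behind (2.78): for `a, b ≥ 0` with `|a − b| ≤ δ` and `b ≤ M`,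
`|a⁴ − b⁴| = |a − b|(a + b)(a² + b²) ≤ 4δ(M + δ)³`. [cite: Balaban1982Higgs2, (2.78) p.574] -/
theorem abs_pow_four_sub_pow_four_le {a b δ M : ℝ} (ha : 0 ≤ a) (hb : 0 ≤ b) (hab : |a - b| ≤ δ) (hbM : b ≤ M) :
    |a ^ 4 - b ^ 4| ≤ 4 * δ * (M + δ) ^ 3 := by
  have hδ : 0 ≤ δ := (abs_nonneg _).trans hab
  have haM : a ≤ M + δ := by
    have := (abs_sub_le_iff.1 hab).1
    linarith
  have hMδ : 0 ≤ M + δ := ha.trans haM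
  have hfac : a ^ 4 - b ^ 4 = (a - b) * ((a + b) * (a ^ 2 + b ^ 2)) := by ring
  have h2 : 0 ≤ (a + b) * (a ^ 2 + b ^ 2) := by positivity
  have hs : a + b ≤ 2 * (M + δ) := by linarith
  have hq : a ^ 2 + b ^ 2 ≤ 2 * (M + δ) ^ 2 := by nlinarith
  have h3 : (a + b) * (a ^ 2 + b ^ 2) ≤ 4 * (M + δ) ^ 3 :=
    calc (a + b) * (a ^ 2 + b ^ 2) ≤ (2 * (M + δ)) * (2 * (M + δ) ^ 2) :=
          mul_le_mul hs hq (by positivity) (by positivity)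
      _ = 4 * (M + δ) ^ 3 := by ring
  rw [hfac, abs_mul, abs_of_nonneg h2]
  calc |a - b| * ((a + b) * (a ^ 2 + b ^ 2)) ≤ δ * (4 * (M + δ) ^ 3) := mul_le_mul hab h3 h2 hδ
    _ = 4 * δ * (M + δ) ^ 3 := by ring

end Tools

/-! ## §1 (2.78) p. 574: the quartic term of (2.57) transferred from `φ^{(k)}` to `φ` by Lemma 2.4 -/

section Eq278

variable {Y X V : Type*} [NormedAddCommGroup V]

/-- **(2.78), one k-block.**  DICTIONARY: `B` ↤ the block `B^k(y)` of the fine lattice over the unit-lattice site `y`;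
`w x` ↤ `η^d`, `η = L^{−k}` (p. 570), with `Σ_{x∈B^k(y)} η^d = 1` (`hw1`); `φk` ↤ `φ^{(k)}` of (2.56); `v` ↤ `φ(y)`;
`U x` ↤ the parallel transport `U(A^{(k)}(Γ^{(k)}_{x,y}))`, norm-preserving on `φ(y)` (`hU`); `h265` ↤ Lemma 2.4 (2.65)
with deviation `δ = O(p(L^kε))`; `hM` ↤ (2.55), fourth line, `M = c₁λ(L^{k−1}ε)^{−1/4}p(L^{k−1}ε)`.  Conclusion:
`|Σ_{x∈B^k(y)} η^d|φ^{(k)}(x)|⁴ − |φ(y)|⁴| ≤ 4δ(M + δ)³`. [cite: Balaban1982Higgs2, (2.78) p.574] -/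
theorem quartic278_block (B : Finset X) (w : X → ℝ) (φk : X → V) (v : V) (U : X → V → V) {δ M : ℝ}
    (hw0 : ∀ x ∈ B, 0 ≤ w x) (hw1 : ∑ x ∈ B, w x = 1) (hU : ∀ x ∈ B, ‖U x v‖ = ‖v‖)
    (h265 : ∀ x ∈ B, ‖φk x - U x v‖ ≤ δ) (hM : ‖v‖ ≤ M) :
    |∑ x ∈ B, w x * ‖φk x‖ ^ 4 - ‖v‖ ^ 4| ≤ 4 * δ * (M + δ) ^ 3 := by
  have h1 : ‖v‖ ^ 4 = ∑ x ∈ B, w x * ‖v‖ ^ 4 := by rw [← Finset.sum_mul, hw1, one_mul]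
  rw [h1, ← Finset.sum_sub_distrib]
  calc |∑ x ∈ B, (w x * ‖φk x‖ ^ 4 - w x * ‖v‖ ^ 4)|
      ≤ ∑ x ∈ B, |w x * ‖φk x‖ ^ 4 - w x * ‖v‖ ^ 4| := Finset.abs_sum_le_sum_abs _ _
    _ ≤ ∑ x ∈ B, w x * (4 * δ * (M + δ) ^ 3) := by
        refine Finset.sum_le_sum fun x hx => ?_
        rw [← mul_sub, abs_mul, abs_of_nonneg (hw0 x hx)]
        refine mul_le_mul_of_nonneg_left ?_ (hw0 x hx)
        refine abs_pow_four_sub_pow_four_le (norm_nonneg _) (norm_nonneg _) ?_ hM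
        calc |‖φk x‖ - ‖v‖| = |‖φk x‖ - ‖U x v‖| := by rw [hU x hx]
          _ ≤ ‖φk x - U x v‖ := abs_norm_sub_norm_le _ _
          _ ≤ δ := h265 x hx
    _ = 4 * δ * (M + δ) ^ 3 := by rw [← Finset.sum_mul, hw1, one_mul]

/-- **(2.78) p. 574, AS THE ESTIMATE IT IS (schematic carrier, explicit constant).**  DICTIONARY: `S` ↤ the unit-lattice
set `Λ₇^{(k−1)′} ∩ Λ₇^{(k)c}`; `B y` ↤ `B^k(y)`, so `Σ_{y∈S}Σ_{x∈B y}` ↤ `Σ_{x∈B^k(Λ₇^{(k−1)′}∩Λ₇^{(k)c})}`; `w` ↤ `η^d`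
(`hw0`, `hw1`: nonnegative, summing to `1` on each block); `lamk` ↤ `λ(L^kε) ≥ 0`; `φk` ↤ `φ^{(k)}` (2.56); `φ` ↤ `φ`;
`U y x` ↤ `U(A^{(k)}(Γ^{(k)}_{x,y}))` (`hU`: preserves `|φ(y)|`); `h265` ↤ Lemma 2.4 (2.65) with deviation `δ`; `h255`
↤ (2.55), fourth line, with bound `M` on `S ⊆ Λ^{(k−1)′}_{−1}`.  Conclusion ↤ (2.78) with the error term bounded by
`λ(L^kε)·4δ(M + δ)³·|S|`; `quartic278_rate` identifies this with the printed `O((L^kε)^{κ₀})|S|`.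
[cite: Balaban1982Higgs2, (2.78) p.574] -/
theorem quartic278_sum (S : Finset Y) (B : Y → Finset X) (w : X → ℝ) (φk : X → V) (φ : Y → V)
    (U : Y → X → V → V) {lamk δ M : ℝ} (hlam : 0 ≤ lamk)
    (hw0 : ∀ y ∈ S, ∀ x ∈ B y, 0 ≤ w x) (hw1 : ∀ y ∈ S, ∑ x ∈ B y, w x = 1)
    (hU : ∀ y ∈ S, ∀ x ∈ B y, ‖U y x (φ y)‖ = ‖φ y‖)
    (h265 : ∀ y ∈ S, ∀ x ∈ B y, ‖φk x - U y x (φ y)‖ ≤ δ) (h255 : ∀ y ∈ S, ‖φ y‖ ≤ M) :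
    |lamk * ∑ y ∈ S, ∑ x ∈ B y, w x * ‖φk x‖ ^ 4 - lamk * ∑ y ∈ S, ‖φ y‖ ^ 4|
      ≤ lamk * (4 * δ * (M + δ) ^ 3) * S.card := by
  rw [← mul_sub, abs_mul, abs_of_nonneg hlam, ← Finset.sum_sub_distrib, mul_assoc]
  refine mul_le_mul_of_nonneg_left ?_ hlam
  calc |∑ y ∈ S, (∑ x ∈ B y, w x * ‖φk x‖ ^ 4 - ‖φ y‖ ^ 4)|
      ≤ ∑ y ∈ S, |∑ x ∈ B y, w x * ‖φk x‖ ^ 4 - ‖φ y‖ ^ 4| := Finset.abs_sum_le_sum_abs _ _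
    _ ≤ ∑ y ∈ S, 4 * δ * (M + δ) ^ 3 := Finset.sum_le_sum fun y hy =>
        quartic278_block (B y) w φk (φ y) (U y) (hw0 y hy) (hw1 y hy) (hU y hy) (h265 y hy) (h255 y hy)
    _ = 4 * δ * (M + δ) ^ 3 * S.card := by rw [Finset.sum_const, nsmul_eq_mul, mul_comm]

end Eq278

/-! ## §2 (2.78) p. 574: the printed rate `O((L^kε)^{κ₀})` -/

section Rate

/-- **(2.78), the rate.**  With the PRINTED sizes of the two inputs — `δ = C·p(L^kε)` (Lemma 2.4 (2.65): *«O(p(L^kε))»*)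
and `M = c₁λ(L^{k−1}ε)^{−1/4}p(L^{k−1}ε)` ((2.55), fourth line) — and the prefactor `λ(L^kε)` of (2.78), the per-site
error `λ(L^kε)·4δ(M + δ)³` of `quartic278_sum` is `≤ C′(L^kε)^{κ₀}` for every `0 < κ₀ < (4 − d)/4` (`d < 4`; the paper's
`d = 2, 3`), uniformly in `0 < ℓ = L^kε ≤ 1` (`ℓ/L` ↤ `L^{k−1}ε`, `L ≥ 1`).  Mechanism: `λ(ℓ) = L^{4−d}λ(ℓ/L)`,
`p(ℓ) ≤ p(ℓ/L)`, so the error is `≤ 4CL^{4−d}(c₁ + Cλ^{1/4})³·λ(ℓ′)^{1/4}p(ℓ′)⁴`, `ℓ′ = ℓ/L`, and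
`λ(ℓ′)^{1/4}p(ℓ′)⁴ = λ^{1/4}b₀⁴·ℓ′^{(4−d)/4}(1 + log ℓ′⁻¹)^{4p}` loses only a logarithm against the power
(`B2Sect3AGaussianStep.one_add_log_inv_rpow_mul_rpow_le`).  Explicit
`C′ = 4CL^{4−d}(c₁ + Cλ^{1/4})³·b₀⁴λ^{1/4}·max{1, 4p/s}^{4p}`, `s = (4 − d)/4 − κ₀`.
[cite: Balaban1982Higgs2, (2.78) p.574] -/
theorem quartic278_rate (d : ℕ) (hd : d < 4) {lam b₀ pexp L c₁ C κ₀ : ℝ} (hlam : 0 < lam) (hb₀ : 0 ≤ b₀)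
    (hpexp : 0 < pexp) (hL : 1 ≤ L) (hc₁ : 0 ≤ c₁) (hC : 0 ≤ C) (hκ₀ : 0 < κ₀) (hκ : κ₀ < ((4 : ℝ) - d) / 4) :
    ∃ C' : ℝ, 0 ≤ C' ∧ ∀ ℓ : ℝ, 0 < ℓ → ℓ ≤ 1 →
      lambdaEps lam ℓ d * (4 * (C * B2.pFn b₀ pexp ℓ) *
          (c₁ * B2.pFn b₀ pexp (ℓ / L) / (lambdaEps lam (ℓ / L) d) ^ (1 / 4 : ℝ) + C * B2.pFn b₀ pexp ℓ) ^ 3)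
        ≤ C' * ℓ ^ κ₀ := by
  obtain ⟨n, hn⟩ : ∃ n : ℕ, (4 : ℤ) - (d : ℤ) = n := ⟨4 - d, by omega⟩
  have hnR : ((4 : ℝ) - d) = n := by
    have h := congrArg (Int.cast : ℤ → ℝ) hn
    push_cast at h
    exact h
  set s : ℝ := ((4 : ℝ) - d) / 4 - κ₀ with hs_def
  have hs0 : 0 < s := by rw [hs_def]; linarith
  have h4p : 0 < 4 * pexp := by linarith
  set K : ℝ := (max 1 (4 * pexp / s)) ^ (4 * pexp) with hK_def
  have hK0 : 0 ≤ K := Real.rpow_nonneg (zero_le_one.trans (le_max_left _ _)) _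
  set q₁ : ℝ := lam ^ (1 / 4 : ℝ) with hq₁_def
  have hq₁0 : 0 < q₁ := Real.rpow_pos_of_pos hlam _
  have hL0 : 0 < L := by linarith
  refine ⟨4 * C * L ^ n * (c₁ + C * q₁) ^ 3 * (b₀ ^ 4 * q₁ * K), by positivity, fun ℓ hℓ hℓ1 => ?_⟩
  -- the previous scale `ℓ' = ℓ/L` ↤ `L^{k−1}ε`
  set ℓ' : ℝ := ℓ / L with hℓ'_def
  have hℓ'0 : 0 < ℓ' := div_pos hℓ hL0
  have hℓ'ℓ : ℓ' ≤ ℓ := div_le_self hℓ.le hL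
  have hℓ'1 : ℓ' ≤ 1 := hℓ'ℓ.trans hℓ1
  have hℓeq : ℓ = L * ℓ' := by rw [hℓ'_def]; field_simp
  set P : ℝ := B2.pFn b₀ pexp ℓ' with hP_def
  set Pℓ : ℝ := B2.pFn b₀ pexp ℓ with hPℓ_def
  set Λ : ℝ := lambdaEps lam ℓ' d with hΛ_def
  set q : ℝ := Λ ^ (1 / 4 : ℝ) with hq_def
  have hΛ0 : 0 < Λ := lambdaEps_pos hlam hℓ'0 d
  have hq0 : 0 < q := Real.rpow_pos_of_pos hΛ0 _
  have hq4 : q ^ 4 = Λ := by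
    rw [hq_def, ← Real.rpow_natCast (Λ ^ (1 / 4 : ℝ)) 4, ← Real.rpow_mul hΛ0.le]
    norm_num
  have hP0 : 0 ≤ P := B2Eq236Replacements.pFn_nonneg hb₀ hℓ'0 hℓ'1
  have hPℓP : Pℓ ≤ P := pFn_le_pFn_of_le hb₀ hpexp.le hℓ'0 hℓ'ℓ hℓ1
  have hPℓ0 : 0 ≤ Pℓ := B2Eq236Replacements.pFn_nonneg hb₀ hℓ hℓ1
  -- `Λ = λℓ'^{4−d}` and `λ(ℓ) = L^{4−d}Λ`
  have hΛn : Λ = lam * ℓ' ^ n := by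
    rw [hΛ_def, B2LargeField.lambdaEps, hn, zpow_natCast]
  have hlamℓ : lambdaEps lam ℓ d = L ^ n * Λ := by
    rw [B2LargeField.lambdaEps, hn, zpow_natCast, hΛn, hℓeq, mul_pow]
    ring
  -- `q ≤ q₁`
  have hΛle : Λ ≤ lam := by
    rw [hΛn]
    exact mul_le_of_le_one_right hlam.le (pow_le_one₀ hℓ'0.le hℓ'1)
  have hqq₁ : q ≤ q₁ := Real.rpow_le_rpow hΛ0.le hΛle (by norm_num)
  -- `q = λ^{1/4}ℓ'^{n/4}`
  have hq_eq : q = q₁ * ℓ' ^ ((n : ℝ) / 4) := by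
    rw [hq_def, hΛn, Real.mul_rpow hlam.le (pow_nonneg hℓ'0.le _), hq₁_def, ← Real.rpow_natCast ℓ' n,
      ← Real.rpow_mul hℓ'0.le]
    congr 2
    ring
  -- `P⁴ = b₀⁴(1 + log ℓ'⁻¹)^{4p}`
  have ht0 : 0 ≤ 1 + Real.log ℓ'⁻¹ := by
    rw [Real.log_inv]; have := Real.log_nonpos hℓ'0.le hℓ'1; linarith
  have hP4 : P ^ 4 = b₀ ^ 4 * (1 + Real.log ℓ'⁻¹) ^ (4 * pexp) := by
    rw [hP_def, B2.pFn, mul_pow, ← Real.rpow_natCast ((1 + Real.log ℓ'⁻¹) ^ pexp) 4, ← Real.rpow_mul ht0]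
    congr 2
    push_cast
    ring
  -- the logarithm loses: `(1 + log ℓ'⁻¹)^{4p}ℓ'^{s} ≤ K`
  have hlog : (1 + Real.log ℓ'⁻¹) ^ (4 * pexp) * ℓ' ^ s ≤ K :=
    B2Sect3AGaussianStep.one_add_log_inv_rpow_mul_rpow_le h4p hs0 hℓ'0 hℓ'1
  have hsplit : ℓ' ^ ((n : ℝ) / 4) = ℓ' ^ s * ℓ' ^ κ₀ := by
    rw [← Real.rpow_add hℓ'0]
    congr 1
    rw [hs_def, hnR]
    ring
  have hℓκ : ℓ' ^ κ₀ ≤ ℓ ^ κ₀ := Real.rpow_le_rpow hℓ'0.le hℓ'ℓ hκ₀.le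
  have hP4q : P ^ 4 * q ≤ b₀ ^ 4 * q₁ * K * ℓ ^ κ₀ := by
    rw [hP4, hq_eq, hsplit]
    have hℓ'κ0 : 0 ≤ ℓ' ^ κ₀ := Real.rpow_nonneg hℓ'0.le _
    calc b₀ ^ 4 * (1 + Real.log ℓ'⁻¹) ^ (4 * pexp) * (q₁ * (ℓ' ^ s * ℓ' ^ κ₀))
        = b₀ ^ 4 * q₁ * ((1 + Real.log ℓ'⁻¹) ^ (4 * pexp) * ℓ' ^ s) * ℓ' ^ κ₀ := by ring
      _ ≤ b₀ ^ 4 * q₁ * K * ℓ ^ κ₀ :=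
          mul_le_mul (mul_le_mul_of_nonneg_left hlog (by positivity)) hℓκ hℓ'κ0 (by positivity)
  -- `M + δ ≤ (c₁ + Cq)P/q`
  have hδ : C * Pℓ ≤ C * P := mul_le_mul_of_nonneg_left hPℓP hC
  have hMδ : c₁ * P / q + C * Pℓ ≤ (c₁ + C * q) * P / q := by
    have h2 : (c₁ + C * q) * P / q = c₁ * P / q + C * P := by
      field_simp
    rw [h2]
    linarith
  have hMδ0 : 0 ≤ c₁ * P / q + C * Pℓ := by positivity
  have hcube : (c₁ * P / q + C * Pℓ) ^ 3 ≤ ((c₁ + C * q) * P / q) ^ 3 := pow_le_pow_left₀ hMδ0 hMδ 3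
  have hE : lambdaEps lam ℓ d * (4 * (C * Pℓ) * (c₁ * P / q + C * Pℓ) ^ 3)
      ≤ L ^ n * Λ * (4 * (C * P) * ((c₁ + C * q) * P / q) ^ 3) := by
    rw [hlamℓ]
    refine mul_le_mul_of_nonneg_left ?_ (by positivity)
    exact mul_le_mul (mul_le_mul_of_nonneg_left hδ (by norm_num)) hcube (by positivity) (by positivity)
  have halg : L ^ n * Λ * (4 * (C * P) * ((c₁ + C * q) * P / q) ^ 3)
      = 4 * C * L ^ n * (c₁ + C * q) ^ 3 * (P ^ 4 * q) := by
    rw [← hq4]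
    field_simp
  have hcq : (c₁ + C * q) ^ 3 ≤ (c₁ + C * q₁) ^ 3 :=
    pow_le_pow_left₀ (by positivity : 0 ≤ c₁ + C * q)
      (by linarith [mul_le_mul_of_nonneg_left hqq₁ hC] : c₁ + C * q ≤ c₁ + C * q₁) 3
  calc lambdaEps lam ℓ d * (4 * (C * Pℓ) * (c₁ * P / q + C * Pℓ) ^ 3)
      ≤ L ^ n * Λ * (4 * (C * P) * ((c₁ + C * q) * P / q) ^ 3) := hE
    _ = 4 * C * L ^ n * (c₁ + C * q) ^ 3 * (P ^ 4 * q) := halg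
    _ ≤ 4 * C * L ^ n * (c₁ + C * q₁) ^ 3 * (b₀ ^ 4 * q₁ * K * ℓ ^ κ₀) :=
        mul_le_mul (mul_le_mul_of_nonneg_left hcq (by positivity)) hP4q (by positivity) (by positivity)
    _ = 4 * C * L ^ n * (c₁ + C * q₁) ^ 3 * (b₀ ^ 4 * q₁ * K) * ℓ ^ κ₀ := by ring

/-- **(2.78) p. 574 with its printed error `O((L^kε)^{κ₀})|Λ₇^{(k−1)′} ∩ Λ₇^{(k)c}|`** (schematic carrier): for `d < 4`,
printed constants `λ, b₀, p, L, c₁` and the Lemma-2.4 constant `C`, and every `0 < κ₀ < (4 − d)/4`, ONE constant `C′`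
such that at every scale `0 < ℓ = L^kε ≤ 1`, for all data as in `quartic278_sum` with `δ = C·p(ℓ)` ((2.65)) and
`M = c₁λ(ℓ/L)^{−1/4}p(ℓ/L)` ((2.55)):
`|λ(ℓ)Σ_{y∈S}Σ_{x∈B^k(y)} η^d|φ^{(k)}(x)|⁴ − λ(ℓ)Σ_{y∈S}|φ(y)|⁴| ≤ C′ℓ^{κ₀}|S|`.
[cite: Balaban1982Higgs2, (2.78) p.574] -/
theorem eq278_printed {Y X V : Type*} [NormedAddCommGroup V] (d : ℕ) (hd : d < 4)
    {lam b₀ pexp L c₁ C κ₀ : ℝ} (hlam : 0 < lam) (hb₀ : 0 ≤ b₀) (hpexp : 0 < pexp) (hL : 1 ≤ L) (hc₁ : 0 ≤ c₁)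
    (hC : 0 ≤ C) (hκ₀ : 0 < κ₀) (hκ : κ₀ < ((4 : ℝ) - d) / 4) :
    ∃ C' : ℝ, 0 ≤ C' ∧ ∀ ℓ : ℝ, 0 < ℓ → ℓ ≤ 1 →
      ∀ (S : Finset Y) (B : Y → Finset X) (w : X → ℝ) (φk : X → V) (φ : Y → V) (U : Y → X → V → V),
        (∀ y ∈ S, ∀ x ∈ B y, 0 ≤ w x) → (∀ y ∈ S, ∑ x ∈ B y, w x = 1) →
        (∀ y ∈ S, ∀ x ∈ B y, ‖U y x (φ y)‖ = ‖φ y‖) →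
        (∀ y ∈ S, ∀ x ∈ B y, ‖φk x - U y x (φ y)‖ ≤ C * B2.pFn b₀ pexp ℓ) →
        (∀ y ∈ S, ‖φ y‖ ≤ c₁ * B2.pFn b₀ pexp (ℓ / L) / (lambdaEps lam (ℓ / L) d) ^ (1 / 4 : ℝ)) →
        |lambdaEps lam ℓ d * ∑ y ∈ S, ∑ x ∈ B y, w x * ‖φk x‖ ^ 4 - lambdaEps lam ℓ d * ∑ y ∈ S, ‖φ y‖ ^ 4|
          ≤ C' * ℓ ^ κ₀ * S.card := by
  obtain ⟨C', hC'0, hrate⟩ := quartic278_rate d hd hlam hb₀ hpexp hL hc₁ hC hκ₀ hκ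
  refine ⟨C', hC'0, fun ℓ hℓ hℓ1 S B w φk φ U hw0 hw1 hU h265 h255 => ?_⟩
  have hlamk : 0 ≤ lambdaEps lam ℓ d := (lambdaEps_pos hlam hℓ d).le
  calc |lambdaEps lam ℓ d * ∑ y ∈ S, ∑ x ∈ B y, w x * ‖φk x‖ ^ 4 - lambdaEps lam ℓ d * ∑ y ∈ S, ‖φ y‖ ^ 4|
      ≤ lambdaEps lam ℓ d * (4 * (C * B2.pFn b₀ pexp ℓ) *
          (c₁ * B2.pFn b₀ pexp (ℓ / L) / (lambdaEps lam (ℓ / L) d) ^ (1 / 4 : ℝ) + C * B2.pFn b₀ pexp ℓ) ^ 3) *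
          S.card :=
        quartic278_sum S B w φk φ U hlamk hw0 hw1 hU h265 h255
    _ ≤ C' * ℓ ^ κ₀ * S.card := mul_le_mul_of_nonneg_right (hrate ℓ hℓ hℓ1) (Nat.cast_nonneg _)

end Rate

/-! ## §3 (2.79) p. 574: the large-field convergence factor on `R_s^{(k)}` -/

section Ineq279

variable {Y V : Type*} [NormedAddCommGroup V]

/-- A large-field site of the scalar kind carries a unit of the convergence factor: if `|φ(y)|` exceeds the threshold
`λ(ℓ)^{−1/4}p(ℓ)` of (2.2)/(2.5) (`B2LargeField.thrPhi`), then `p(ℓ)⁴ < λ(ℓ)|φ(y)|⁴` (`λ, ℓ > 0`, `p(ℓ) ≥ 0`).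
[cite: Balaban1982Higgs2, (2.79) p.574] -/
theorem pow_four_lt_of_thrPhi_lt {lam ℓ p : ℝ} (hlam : 0 < lam) (hℓ : 0 < ℓ) (hp : 0 ≤ p) (d : ℕ) {v : V}
    (h : thrPhi lam ℓ d p < ‖v‖) : p ^ 4 < lambdaEps lam ℓ d * ‖v‖ ^ 4 := by
  have hΛ := lambdaEps_pos hlam hℓ d
  have hq0 : 0 < (lambdaEps lam ℓ d) ^ (1 / 4 : ℝ) := Real.rpow_pos_of_pos hΛ _
  have hq4 : ((lambdaEps lam ℓ d) ^ (1 / 4 : ℝ)) ^ 4 = lambdaEps lam ℓ d := by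
    rw [← Real.rpow_natCast ((lambdaEps lam ℓ d) ^ (1 / 4 : ℝ)) 4, ← Real.rpow_mul hΛ.le]
    norm_num
  rw [B2LargeField.thrPhi, div_lt_iff₀ hq0] at h
  calc p ^ 4 < (‖v‖ * (lambdaEps lam ℓ d) ^ (1 / 4 : ℝ)) ^ 4 := pow_lt_pow_left₀ h hp (by norm_num)
    _ = lambdaEps lam ℓ d * ‖v‖ ^ 4 := by rw [mul_pow, hq4, mul_comm]

/-- **(2.79) p. 574, on the support of `χ^c_{R_s^{(k)}}`.**  DICTIONARY: `S` ↤ `Λ₇^{(k−1)′} ∩ Λ₇^{(k)c}`; `R` ↤ `R_s^{(k)}`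
with `hR : R ⊆ S` (HONEST SCOPE (iv)); `φ` ↤ `φ`; `lam, ℓ, d` ↤ `λ, L^kε, d` (`lambdaEps lam ℓ d` = λ(L^kε)); `p` ↤
`p(L^kε) ≥ 0`; `hlarge` ↤ the support condition of `χ^c_{R_s^{(k)}} = Π_{y∈R_s^{(k)}} χ({|φ(y)| > λ(L^kε)^{−1/4}p(L^kε)})`.
Conclusion ↤ `exp(−λ(L^kε)Σ_{y∈S}|φ(y)|⁴) ≤ exp(−p(L^kε)⁴|R_s^{(k)}|)`.  (First-step twin with the mass counterterm and
`½p(ε)⁴`: `B2Ineq213SmallFactors.ineq213_chi`, (2.13).) [cite: Balaban1982Higgs2, (2.79) p.574] -/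
theorem ineq279 {S R : Finset Y} (hR : R ⊆ S) (φ : Y → V) {lam ℓ p : ℝ} (hlam : 0 < lam) (hℓ : 0 < ℓ)
    (hp : 0 ≤ p) (d : ℕ) (hlarge : ∀ y ∈ R, thrPhi lam ℓ d p < ‖φ y‖) :
    Real.exp (-(lambdaEps lam ℓ d * ∑ y ∈ S, ‖φ y‖ ^ 4)) ≤ Real.exp (-(p ^ 4 * R.card)) := by
  rw [Real.exp_le_exp, neg_le_neg_iff]
  have hΛ := (lambdaEps_pos hlam hℓ d).le
  calc p ^ 4 * R.card = ∑ y ∈ R, p ^ 4 := by rw [Finset.sum_const, nsmul_eq_mul, mul_comm]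
    _ ≤ ∑ y ∈ R, lambdaEps lam ℓ d * ‖φ y‖ ^ 4 :=
        Finset.sum_le_sum fun y hy => (pow_four_lt_of_thrPhi_lt hlam hℓ hp d (hlarge y hy)).le
    _ ≤ ∑ y ∈ S, lambdaEps lam ℓ d * ‖φ y‖ ^ 4 :=
        Finset.sum_le_sum_of_subset_of_nonneg hR fun y _ _ => mul_nonneg hΛ (pow_nonneg (norm_nonneg _) _)
    _ = lambdaEps lam ℓ d * ∑ y ∈ S, ‖φ y‖ ^ 4 := by rw [Finset.mul_sum]

/-- **(2.79) p. 574, LITERALLY**: `χ^c_{R_s^{(k)}}·exp(−λ(L^kε)Σ_{y∈S}|φ(y)|⁴) ≤ exp(−p(L^kε)⁴|R_s^{(k)}|)`, the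
characteristic function written out as the product over `y ∈ R_s^{(k)}` of the indicators `χ({|φ(y)| >
λ(L^kε)^{−1/4}p(L^kε)})` of (2.5) (with ε → L^kε, p. 570); off its support the left side vanishes.  Same dictionary as
`ineq279`. [cite: Balaban1982Higgs2, (2.79) p.574] -/
theorem ineq279_printed {S R : Finset Y} (hR : R ⊆ S) (φ : Y → V) {lam ℓ p : ℝ} (hlam : 0 < lam) (hℓ : 0 < ℓ)
    (hp : 0 ≤ p) (d : ℕ) :
    (∏ y ∈ R, if thrPhi lam ℓ d p < ‖φ y‖ then (1 : ℝ) else 0) *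
        Real.exp (-(lambdaEps lam ℓ d * ∑ y ∈ S, ‖φ y‖ ^ 4)) ≤ Real.exp (-(p ^ 4 * R.card)) := by
  by_cases hall : ∀ y ∈ R, thrPhi lam ℓ d p < ‖φ y‖
  · have h1 : (∏ y ∈ R, if thrPhi lam ℓ d p < ‖φ y‖ then (1 : ℝ) else 0) = 1 :=
      Finset.prod_eq_one fun y hy => by rw [if_pos (hall y hy)]
    rw [h1, one_mul]
    exact ineq279 hR φ hlam hℓ hp d hall
  · push Not at hall
    obtain ⟨y, hy, hle⟩ := hall
    have h0 : (∏ y ∈ R, if thrPhi lam ℓ d p < ‖φ y‖ then (1 : ℝ) else 0) = 0 :=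
      Finset.prod_eq_zero hy (by rw [if_neg (not_lt.2 hle)])
    rw [h0, zero_mul]
    exact (Real.exp_pos _).le

end Ineq279

end Literature.MathematicalPhysics.QuantumFieldTheory.Balaban1983to89.B2Eq278QuarticTransfer
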